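import Mathlib
import Summits.NavierStokesRegularity.NavierStokesRegularity.Theorems.PoloidalWindowDoorPoloidalWindowRigidityZShockSimpleWaves

/-!
# Crux K2 `PoloidalWindowRigidity` (stmt-NavierStokesRegularity-19708), line `z_shock` — 2+1-D simple waves in the `fderiv` CURRENCY of
# `hGN` / the registered stubs

`--supports stmt-NavierStokesRegularity-19708 --as helper` (leafhand-ns-poloidalwindowdoor-3 g24, cell decomp-ns, 2026-09-01).  Class-free,
def-free; a thin re-statement layer over the same hand's `…ZShockSimpleWaves.simpleWave_solves` (split off for the 400-line rule).
**No stub and no summit is closed by this file; Navier–Stokes regularity is NOT proved here (rung 0).**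

`…ZShockSimpleWaves.simpleWave_solves` takes the first and second directional derivatives of the simple wave `w` as `HasDerivAt` data
along lines.  The class-free deciding statement `hGN` (`…ZShockAutOfSliceLiouville`) and the four registered stubs of skeleton `z_shock`
speak instead in Fréchet derivatives — `fderiv ℝ u y (EuclideanSpace.single j 1) i` and
`fderiv ℝ (fun x => fderiv ℝ u x (single 2 1) 2) y (single 0 1)`.  This file provides the bridge:

* `hasDerivAt_line_of_differentiableAt` — `DifferentiableAt ℝ f Y ⇒ HasDerivAt (t ↦ f (Y + t•v)) (fderiv ℝ f Y v) 0` (bookkeeping);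
* ★ `simpleWave_solves_fderiv` — plane identity `⟪n (w Y), Y⟫ = 1` on an open `U ∋ X`, `w` differentiable on `U`, the three partial maps
  `Y ↦ fderiv ℝ w Y eᵢ` differentiable at `X`, the normal curve `C²` along the values and NULL for `Λ`, `D = ⟪n'(w X), X⟫ ≠ 0` ⟹
  `∂₂∂₂w + Λ(w)(∂₀∂₀w + ∂₁∂₁w) + Λ'(w)((∂₀w)² + (∂₁w)²) = 0` at `X` with `∂ᵢ∂ⱼw := fderiv ℝ (fun Y => fderiv ℝ w Y eⱼ) X eᵢ`, for ANY three
  vectors `e₀, e₁, e₂` of any real inner-product space — in `EuclideanSpace ℝ (Fin 3)` with `eᵢ = EuclideanSpace.single i 1` this is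
  literally the height-evolution clause pattern of the stubs.

Honest scope: kinematic toy rung; `hGN` / R3 stay XL, not in print. [folklore]
-/

noncomputable section

namespace Summit.NavierStokesRegularity.NavierStokesRegularity.Theorems.PoloidalWindowDoorPoloidalWindowRigidityZShockSimpleWavesFderiv

-- the summit and its single sub-problem share the name (CONVENTIONS §1)
set_option linter.dupNamespace false

open Set Filter Topology
open scoped RealInnerProductSpace
open Summit.NavierStokesRegularity.NavierStokesRegularity.Theorems.PoloidalWindowDoorPoloidalWindowRigidityZShockSimpleWaves

/-- **Directional derivative along a line from `DifferentiableAt`** (bookkeeping): if `f` is differentiable at `Y` then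
`t ↦ f (Y + t•v)` has derivative `fderiv ℝ f Y v` at `0`. [folklore] -/
theorem hasDerivAt_line_of_differentiableAt {E : Type*} [NormedAddCommGroup E] [InnerProductSpace ℝ E]
    {f : E → ℝ} {Y v : E} (hf : DifferentiableAt ℝ f Y) :
    HasDerivAt (fun t : ℝ => f (Y + t • v)) (fderiv ℝ f Y v) 0 := by
  have hline : HasDerivAt (fun t : ℝ => Y + t • v) v 0 := by
    have h := ((hasDerivAt_id (0 : ℝ)).smul_const v).const_add Y
    simpa using h
  have h0 : Y = (fun t : ℝ => Y + t • v) 0 := by simp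
  exact hf.hasFDerivAt.comp_hasDerivAt_of_eq (0 : ℝ) hline h0

/-- ★ **Simple waves solve the height-evolution — `fderiv` currency.**  Same as `simpleWave_solves`, with the derivatives of `w` taken as
Fréchet derivatives: `w` differentiable on the open set `U` (plane identity `⟪n (w Y), Y⟫ = 1` on `U`), the three partial-derivative maps
`Y ↦ ∂_{eᵢ}w(Y) = fderiv ℝ w Y eᵢ` differentiable at `X`, the normal curve `C²` along the values with `D = ⟪n'(w X), X⟫ ≠ 0` and NULL for
`Λ`.  Then, in the letters of `hGN` / the stubs (`∂ᵢ∂ⱼw = fderiv ℝ (fun Y => fderiv ℝ w Y eⱼ) X eᵢ`):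
`∂₂∂₂w + Λ(w)(∂₀∂₀w + ∂₁∂₁w) + Λ'(w)((∂₀w)² + (∂₁w)²) = 0` at `X`. [folklore] -/
theorem simpleWave_solves_fderiv {E : Type*} [NormedAddCommGroup E] [InnerProductSpace ℝ E]
    {w : E → ℝ} {n n' : ℝ → E} {n''₀ X e₀ e₁ e₂ : E} {Λ : ℝ → ℝ} {Λ' : ℝ} {U : Set E}
    (hU : IsOpen U) (hX : X ∈ U) (hplane : ∀ Y ∈ U, ⟪n (w Y), Y⟫ = 1)
    (hn : ∀ s, HasDerivAt n (n' s) s) (hn' : HasDerivAt n' n''₀ (w X))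
    (hwd : ∀ Y ∈ U, DifferentiableAt ℝ w Y)
    (hw₀₀ : DifferentiableAt ℝ (fun Y => fderiv ℝ w Y e₀) X)
    (hw₁₁ : DifferentiableAt ℝ (fun Y => fderiv ℝ w Y e₁) X)
    (hw₂₂ : DifferentiableAt ℝ (fun Y => fderiv ℝ w Y e₂) X)
    (hD : ⟪n' (w X), X⟫ ≠ 0) (hΛ : HasDerivAt Λ Λ' (w X))
    (hnull : ∀ s, ⟪n s, e₂⟫ * ⟪n s, e₂⟫ + Λ s * (⟪n s, e₀⟫ * ⟪n s, e₀⟫ + ⟪n s, e₁⟫ * ⟪n s, e₁⟫) = 0) :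
    fderiv ℝ (fun Y => fderiv ℝ w Y e₂) X e₂ +
        Λ (w X) * (fderiv ℝ (fun Y => fderiv ℝ w Y e₀) X e₀ + fderiv ℝ (fun Y => fderiv ℝ w Y e₁) X e₁) +
      Λ' * (fderiv ℝ w X e₀ ^ 2 + fderiv ℝ w X e₁ ^ 2) = 0 :=
  simpleWave_solves (dw := fun Y v => fderiv ℝ w Y v) hU hX hplane hn hn'
    (fun Y hY _ => hasDerivAt_line_of_differentiableAt (hwd Y hY))
    (hasDerivAt_line_of_differentiableAt hw₀₀) (hasDerivAt_line_of_differentiableAt hw₁₁)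
    (hasDerivAt_line_of_differentiableAt hw₂₂) hD hΛ hnull

end Summit.NavierStokesRegularity.NavierStokesRegularity.Theorems.PoloidalWindowDoorPoloidalWindowRigidityZShockSimpleWavesFderiv
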